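import Literature.AnabelianGeometry.AbsoluteAnabelian.AbsTopIII.KummerDescentLaws
import Literature.AnabelianGeometry.AbsoluteAnabelian.AbsTopIII.Thm19KummerTower
import HarnessLib

/-!
# [AbsTopIII] Thm. 1.9 (d): geometric TAGS of a directed system of NF-complements (bridge from the
# per-curve laws to the per-system tower — structure only)

Mochizuki, *Topics in Absolute Anabelian Geometry III*, §1, Theorem 1.9 (d), manuscript pp. 37–38 (lit key
`paper:url-5493eb38cbb7`): "`V` ranges over the open subschemes obtained by removing finite collections of
NF-points from `Z ×_{k_Z} k′`, for `k′` a finite extension of `k_Z`".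

Cell abc-iut, sub-DAG `plan/L4/SUBDAG-AbsTopIII-Thm19.md` rows Thm19.d (abc-iut-L4-lead RULING #4a: bridge
`NFTower.ofCurveLaws`).  abc-iut-w5-d213's `CurveModel.NFComplementSystem` records the transitions
`Π_{V_j} → Π_{V_i}` and the legs `Π_{Z ×_{k_Z} k′_i} → Π_Z` of a directed system as BARE homomorphisms of
extensions; abc-iut-L4-t1's successor structures (`NaturalKummerModel` ⊆ `TowerKummerModel` ⊆
`DescentKummerModel`) carry the laws of cofinite opens and of base-change legs AS MODEL RELATIONS.  To
derive the per-system tower `IntrinsicKummerModel.NFTower` from those laws one must know that the system's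
bare homomorphisms ARE geometric: THIS FILE types that datum — `GeomTags N S`: every leg `Z_i → Z` is the
model's base-change leg, every transition factors as the open immersion `V_j ⊆ W_{ij} := V_i ×_{k′_i} k′_j`
(a cofinite open of `Z_j = Z ×_{k_Z} k′_j`) followed by the model's base-change leg `W_{ij} → V_i` over
`Z_j → Z_i`, coherently with the legs to `Z` — together with the COFINALITY of the system among all
NF-complements ("`V` ranges over" all of them: later levels dominate every finite base change and
remove every NF-point; the base fields exhaust `k̄_NF`, every element of `K_{Z_NF}^×` becomes a regular
unit, nonconstant NF-rational units appear), which is a property of the SYSTEM, not of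
the model, hence not a law.  Data ABOUT `S`; no new Prop fact; the construction of the tower from the tags
is the proof-only sibling `Thm19KummerTowerBridgeProofs.lean`.  HONEST FRAMING: typed ≠ proved; nothing
here bears on [IUTchIII] Cor. 3.12.
-/

noncomputable section

open CategoryTheory

namespace Literature.AnabelianGeometry.AbsoluteAnabelian.AbsTopIII

universe u

namespace CurveModel.NFComplementSystem

/-- **Geometric tags of a directed system of NF-complements** over a `DescentKummerModel` (Thm. 1.9 (d)
"`V` ranges over the open subschemes obtained by removing [...] NF-points from `Z ×_{k_Z} k′`"): the legs
`Z_i → Z` are base-change legs of the model; each transition `V_j → V_i` (`i ≤ j`) is the open immersion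
`V_j ⊆ W_{ij}` into a cofinite open `W_{ij} ⊆ Z_j` followed by the base-change leg `W_{ij} → V_i` over the
base-change leg `Z_j → Z_i`, compatibly with the legs to `Z`; and the system is COFINAL (base fields
exhaust `k̄_NF`; every element of `K_{Z_NF}^×` is eventually a regular unit of a level; nonconstant
NF-rational regular units occur cofinally).  Interface data about the system `S`.
[cite: MochizukiAbsTopIII2015, Thm 1.9 (d) p.37] -/
structure GeomTags (N : DescentKummerModel.{u}) {Z : N.Curve} {ι : Type u} [Preorder ι]
    (S : CurveModel.NFComplementSystem N.toCurveModel Z ι) : Type (u + 1) where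
  /-- `Z_i = Z ×_{k_Z} k′_i` is a base change of `Z` in the model ... -/
  hZb : ∀ i : ι, N.IsBaseChangeOf (S.Zb i) Z
  /-- ... and the system's leg `Π_{Z_i} → Π_Z` is the model's -/
  bc_eq : ∀ i : ι, S.bc i = N.bc (hZb i)
  /-- `W_{ij} = V_i ×_{k′_i} k′_j` for `i ≤ j` -/
  W : ∀ ⦃i j : ι⦄, i ≤ j → N.Curve
  /-- `V_j ⊆ W_{ij}` is a cofinite open ("removing finite collections of NF-points") -/
  hVW : ∀ ⦃i j : ι⦄ (h : i ≤ j), N.IsCofiniteOpen (S.V j) (W h)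
  /-- `W_{ij} ⊆ Z_j` is a cofinite open -/
  hWZ : ∀ ⦃i j : ι⦄ (h : i ≤ j), N.IsCofiniteOpen (W h) (S.Zb j)
  /-- `W_{ij} → V_i` is a base-change leg -/
  hWV : ∀ ⦃i j : ι⦄ (h : i ≤ j), N.IsBaseChangeOf (W h) (S.V i)
  /-- `Z_j → Z_i` is a base-change leg -/
  hZZ : ∀ ⦃i j : ι⦄ (h : i ≤ j), N.IsBaseChangeOf (S.Zb j) (S.Zb i)
  /-- the transition `Π_{V_j} → Π_{V_i}` is `(V_j ⊆ W_{ij}) ≫ (W_{ij} → V_i)` -/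
  trans_eq : ∀ ⦃i j : ι⦄ (h : i ≤ j), S.trans h = N.res (hVW h) ≫ N.bc (hWV h)
  /-- the legs to `Z` compose: `(Z_j → Z_i) ≫ (Z_i → Z) = (Z_j → Z)` -/
  bc_trans : ∀ ⦃i j : ι⦄ (h : i ≤ j), N.bc (hZZ h) ≫ S.bc i = S.bc j
  /-- COFINALITY (levels): every finite base change `Z′ → Z_i` of a level's compactification is dominated
  by a later level, `Z_j → Z′` ("for `k′` a[ny] finite extension of `k_Z`") -/
  cofinal : ∀ (i : ι) (Z' : N.Curve), N.IsBaseChangeOf Z' (S.Zb i) →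
    ∃ j : ι, i ≤ j ∧ N.IsBaseChangeOf (S.Zb j) Z'
  /-- COFINALITY (points): every NF-point `y` of a level `V_i` is removed at some later level — a cusp of
  `V_j` fills a point of `W_{ij}` lying over `y` ("removing [arbitrary] finite collections of NF-points";
  the geometric form of `NFComplementSystem.eventually_removed`) -/
  removed_cofinal : ∀ (i : ι) (y : N.Point (S.V i)), N.IsNFPoint (S.V i) y →
    ∃ (j : ι) (h : i ≤ j) (c : (N.cusps (S.V j)).Cusp) (w : N.Point (W h)),
      N.cuspPt (hVW h) c = some w ∧ N.bcPt (hWV h) w = y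
  /-- COFINALITY (base fields): every element of `k̄_NF` lies in `k′_j` for some later level `j` -/
  base_cofinal : ∀ (i : ι) (a : AlgebraicClosure (N.base Z)), a ∈ N.kbarNF Z →
    ∃ j : ι, i ≤ j ∧ a ∈ Set.range fun c : N.base (S.V j) => N.bcEmb (hZb j) ((N.baseRes (S.isOpen j)).symm c)
  /-- COFINALITY (functions): every `a ∈ K_{Z_NF}^×` is, at some later level `j`, (the descent of) a regular
  unit of `V_j` -/
  fn_cofinal : ∀ (i : ι) (a : N.NFFunctionField Z), a ≠ 0 → ∃ j : ι, i ≤ j ∧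
    ∃ f : N.regularUnits (S.V j),
      N.toGeom (hZb j) ((N.fieldRes (S.isOpen j)).symm ((f : (N.FunctionField (S.V j))ˣ) : _)) =
        N.nfToGeom Z a
  /-- COFINALITY (richness): nonconstant NF-rational regular units occur at cofinally many levels -/
  rich : ∀ i : ι, ∃ (j : ι) (_ : i ≤ j) (g : N.regularUnits (S.V j)),
    N.IsNFRational (S.V j) ((g : (N.FunctionField (S.V j))ˣ) : N.FunctionField (S.V j)) ∧
      ¬ N.IsConstantUnit (g : (N.FunctionField (S.V j))ˣ)

end CurveModel.NFComplementSystem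

end Literature.AnabelianGeometry.AbsoluteAnabelian.AbsTopIII
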